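import Summits.CriticalPhenomena.PercolationContinuityZ3.Theorems.PercNearOneGluingNoHeavyLowerTailSahiE3ExchangeOverflow
import Summits.CriticalPhenomena.PercolationContinuityZ3.Theorems.PercNearOneGluingNoHeavyLowerTailSahiE3ExchangeNested
import Mathlib.Tactic.Linarith
import Mathlib.Tactic.Ring
import Mathlib.Tactic.Positivity
import HarnessLib
import HarnessLib.Audit

/-!
# `NoHeavyLowerTail` (crux stmt-CriticalPhenomena-4575), Sahi programme P4: the FLOW-NORMAL 2×2 exchange lemma in the GENERAL class — PROVED

Support file (cell `prim-l12`, seat P4, generation 29; `--supports stmt-CriticalPhenomena-4575`).  No named facts, no sorries;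
standard axioms; def-free.

Context (HOME prim-l12-p4/FROM-prim-l12-p4-gen29-GENERAL-FLOW-NORMAL.md; predecessors `…SahiE3ExchangeCross` (crossing identity,
crossing-free case), `…SahiE3ExchangeOverflow` (overflow bound, general class), `…SahiE3ExchangeFlowNormal` (pure class)).
Harris block `(B, w, V)` (`w ≥ 0` of mass `1`, slot `V`, `v = w(V)`, `a(X) = w(X∩V)`, `need(X,Y) = x·a(Y) + y·a(X) − v·x·y`),
GENERAL configuration `O ⊆ K∩L`, `K∪L ⊆ P`, `O' ⊆ K'∩L'`, `K'∪L' ⊆ P'` (no nesting between `K` and `L`, nor between `K'` and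
`L'`), crossing cells `Ξ₁ = (K∖L)∩(L'∖K')∩V`, `Ξ₂ = (L∖K)∩(K'∖L')∩V`, and the two bracket shapes `EXCH₂`, `EXCH₁` of the OR-peel
(the conclusions of `exchange_of_noCross₂/₁`, `exchange_of_overflow₂/₁`).  Generation 28 proved the pure class (`L ⊆ K`,
`K' ⊆ L'`, `P = K`, `O = L`, `P' = L'`, `O' = K'`) by the dichotomy {same-footprint packing, cross packing with overflow} and
recorded that this 2-member dichotomy FAILS in the general class (exact `n = 3` witness).  This file proves the general class
with the corrected dichotomy {UNCROSSED same-footprint packing, cross packing with overflow}: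
* the UNCROSSED packing `(K∪L, K'∩L'), (K∩L, K'∪L')` is admissible for every `R ≥ 0` on `V`
  (`uncrossed_footprints_le_supply`: pointwise `1_{K∪L}1_{K'∩L'} + 1_{K∩L}1_{K'∪L'} ≤ 1_K1_{K'} + 1_L1_{L'}`) and leaves
  exactly the deficit `need(K∖L, L'∖K') + need(L∖K, K'∖L')` (bilinearity of `need`, `uncrossed_value`);
* the base `X_a + (1−v)·Y` dominates `w(Ξ₁) + w(Ξ₂) + (1−v)·[m₁m₁' + m₂m₂']` with `m₁ = w(K∖L)`, `m₁' = w(L'∖K')`,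
  `m₂ = w(L∖K)`, `m₂' = w(K'∖L')` (`crossing_cells_le_modularity` + three Harris inequalities; both brackets);
* with `T = w(Ξ₁) + w(Ξ₂) − m₁m₁' − m₂m₂'`: the uncrossed packing gives `EXCH ≥ T` (because
  `(1−v)·m·m' − need = c·c' − a·a' ≥ −m·m'`), the cross packing with flow-normal overflow gives `EXCH ≥ −(1−v)·T`
  (`…ExchangeOverflow`); one of the two is nonnegative (`exchange_flowNormal₂`, `exchange_flowNormal₁`).
In the pure class the uncrossed packing IS the same-footprint packing, so this contains generation 28's theorem.  The hypotheses
on `R` are: `R ≥ 0` on `V`, the pair inequality at the four pairs `(K∪L, K'∩L')`, `(K∩L, K'∪L')`, `(K,L')`, `(L,K')`, and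
flow-normality on the crossing cells `R(Ξ₁) + R(Ξ₂) ≤ (2−v)·(w(Ξ₁) + w(Ξ₂))` (every `R ≤ (2−v)·w` on `V`, in particular every
natural certificate); the certificate-free version is false (generation 28's Bool⁵ witnesses).  [this work]
-/

namespace Summit.CriticalPhenomena.PercolationContinuityZ3.Theorems.SahiE3ExchangeGeneral

open Finset SahiE3DimerPacking SahiE3ExchangeCross SahiE3ExchangeOverflow SahiE3ExchangeNested
open scoped BigOperators

variable {B : Type*} [DecidableEq B]

/-- **Admissibility of the uncrossed packing.**  For `R ≥ 0` on `V` and any finite sets `K, L, K', L'`: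
`R((K∪L)∩(K'∩L')∩V) + R((K∩L)∩(K'∪L')∩V) ≤ R(K∩K'∩V) + R(L∩L'∩V)`
(pointwise `1_{K∪L}1_{K'∩L'} + 1_{K∩L}1_{K'∪L'} ≤ 1_K1_{K'} + 1_L1_{L'}`, strict exactly on the parallel cells). [this work] -/
theorem uncrossed_footprints_le_supply (R : B → ℝ) (V K L K' L' : Finset B) (hR : ∀ b ∈ V, 0 ≤ R b) :
    ∑ b ∈ ((K ∪ L) ∩ (K' ∩ L')) ∩ V, R b + ∑ b ∈ ((K ∩ L) ∩ (K' ∪ L')) ∩ V, R b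
      ≤ ∑ b ∈ (K ∩ K') ∩ V, R b + ∑ b ∈ (L ∩ L') ∩ V, R b := by
  simp only [sum_inter_eq_sum_ite, ← Finset.sum_add_distrib]
  refine Finset.sum_le_sum fun b hb => ?_
  have hRb := hR b hb
  by_cases hk : b ∈ K <;> by_cases hl : b ∈ L <;> by_cases hk' : b ∈ K' <;> by_cases hl' : b ∈ L' <;>
    simp only [Finset.mem_inter, Finset.mem_union, hk, hl, hk', hl', and_true, and_false,
      and_self, or_true, or_false, ↓reduceIte, add_zero, zero_add, le_refl] <;>
    linarith

/-- **Value of the uncrossed packing** (bilinearity of `need`).  With `need(X,Y) = x·a(Y) + y·a(X) − v·x·y`: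
`need(K∪L, K'∩L') + need(K∩L, K'∪L') = need(K,L') + need(L,K') − need(K∖L, L'∖K') − need(L∖K, K'∖L')`, the differences
written with `w(K∖L) = w(K) − w(K∩L)`, `a(K∖L) = a(K) − a(K∩L)` etc. [this work] -/
theorem uncrossed_value (w : B → ℝ) (V K L K' L' : Finset B) (v : ℝ) :
    (∑ b ∈ K ∪ L, w b) * (∑ b ∈ (K' ∩ L') ∩ V, w b) + (∑ b ∈ K' ∩ L', w b) * (∑ b ∈ (K ∪ L) ∩ V, w b)
        - v * (∑ b ∈ K ∪ L, w b) * (∑ b ∈ K' ∩ L', w b)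
      + ((∑ b ∈ K ∩ L, w b) * (∑ b ∈ (K' ∪ L') ∩ V, w b) + (∑ b ∈ K' ∪ L', w b) * (∑ b ∈ (K ∩ L) ∩ V, w b)
        - v * (∑ b ∈ K ∩ L, w b) * (∑ b ∈ K' ∪ L', w b))
    = ((∑ b ∈ K, w b) * (∑ b ∈ L' ∩ V, w b) + (∑ b ∈ L', w b) * (∑ b ∈ K ∩ V, w b)
          - v * (∑ b ∈ K, w b) * (∑ b ∈ L', w b))
      + ((∑ b ∈ L, w b) * (∑ b ∈ K' ∩ V, w b) + (∑ b ∈ K', w b) * (∑ b ∈ L ∩ V, w b)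
          - v * (∑ b ∈ L, w b) * (∑ b ∈ K', w b))
      - (((∑ b ∈ K, w b) - ∑ b ∈ K ∩ L, w b) * ((∑ b ∈ L' ∩ V, w b) - ∑ b ∈ (K' ∩ L') ∩ V, w b)
          + ((∑ b ∈ L', w b) - ∑ b ∈ K' ∩ L', w b) * ((∑ b ∈ K ∩ V, w b) - ∑ b ∈ (K ∩ L) ∩ V, w b)
          - v * ((∑ b ∈ K, w b) - ∑ b ∈ K ∩ L, w b) * ((∑ b ∈ L', w b) - ∑ b ∈ K' ∩ L', w b))
      - (((∑ b ∈ L, w b) - ∑ b ∈ K ∩ L, w b) * ((∑ b ∈ K' ∩ V, w b) - ∑ b ∈ (K' ∩ L') ∩ V, w b)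
          + ((∑ b ∈ K', w b) - ∑ b ∈ K' ∩ L', w b) * ((∑ b ∈ L ∩ V, w b) - ∑ b ∈ (K ∩ L) ∩ V, w b)
          - v * ((∑ b ∈ L, w b) - ∑ b ∈ K ∩ L, w b) * ((∑ b ∈ K', w b) - ∑ b ∈ K' ∩ L', w b)) := by
  have h1 : ∑ b ∈ K ∪ L, w b = ∑ b ∈ K, w b + ∑ b ∈ L, w b - ∑ b ∈ K ∩ L, w b := by
    have := Finset.sum_union_inter (s₁ := K) (s₂ := L) (f := w); linarith
  have h2 : ∑ b ∈ K' ∪ L', w b = ∑ b ∈ K', w b + ∑ b ∈ L', w b - ∑ b ∈ K' ∩ L', w b := by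
    have := Finset.sum_union_inter (s₁ := K') (s₂ := L') (f := w); linarith
  have h3 := sum_union_trace w V K L
  have h4 := sum_union_trace w V K' L'
  rw [h1, h2, h3, h4]
  ring

/-- **The product of nested differences, traced on the slot.**  For `O ⊆ P`, `O' ⊆ P'`:
`w((P∖O)∩(P'∖O')∩V) = a(P∩P') + a(O∩O') − a(P∩O') − a(O∩P')`. [folklore] -/
theorem sum_nested_diff_cell (w : B → ℝ) (V P O P' O' : Finset B) (hO : O ⊆ P) (hO' : O' ⊆ P') :
    ∑ b ∈ ((P \ O) ∩ (P' \ O')) ∩ V, w b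
      = ∑ b ∈ (P ∩ P') ∩ V, w b + ∑ b ∈ (O ∩ O') ∩ V, w b
        - ∑ b ∈ (P ∩ O') ∩ V, w b - ∑ b ∈ (O ∩ P') ∩ V, w b := by
  have h : ∑ b ∈ ((P \ O) ∩ (P' \ O')) ∩ V, w b + ∑ b ∈ (P ∩ O') ∩ V, w b + ∑ b ∈ (O ∩ P') ∩ V, w b
      = ∑ b ∈ (P ∩ P') ∩ V, w b + ∑ b ∈ (O ∩ O') ∩ V, w b := by
    simp only [sum_inter_eq_sum_ite, ← Finset.sum_add_distrib]
    refine Finset.sum_congr rfl fun b _ => ?_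
    simp only [Finset.mem_inter, Finset.mem_sdiff]
    by_cases hp : b ∈ P <;> by_cases ho : b ∈ O <;> by_cases hp' : b ∈ P' <;> by_cases ho' : b ∈ O' <;>
      simp only [hp, ho, hp', ho', and_true, and_false, and_self, not_true, not_false_eq_true,
        ↓reduceIte, add_zero, zero_add] <;>
      first
        | exact absurd (hO ho) hp
        | exact absurd (hO' ho') hp'
  linarith

/-- **The crossing cells sit inside the product of the nested differences.**  For `w ≥ 0` on `V` and the general nestings
`O ⊆ K ⊆ P`, `O ⊆ L ⊆ P`, `O' ⊆ K' ⊆ P'`, `O' ⊆ L' ⊆ P'`: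
`w(Ξ₁) + w(Ξ₂) ≤ a(P∩P') + a(O∩O') − a(P∩O') − a(O∩P')` (the two crossing cells are disjoint cells of `(P∖O)∩(P'∖O')∩V`).
[this work] -/
theorem crossing_cells_le_modularity (w : B → ℝ) (V K L P O K' L' P' O' : Finset B) (hw : ∀ b ∈ V, 0 ≤ w b)
    (hOK : O ⊆ K) (hOL : O ⊆ L) (hKP : K ⊆ P) (hLP : L ⊆ P)
    (hOK' : O' ⊆ K') (hOL' : O' ⊆ L') (hKP' : K' ⊆ P') (hLP' : L' ⊆ P') :
    ∑ b ∈ ((K \ L) ∩ (L' \ K')) ∩ V, w b + ∑ b ∈ ((L \ K) ∩ (K' \ L')) ∩ V, w b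
      ≤ ∑ b ∈ (P ∩ P') ∩ V, w b + ∑ b ∈ (O ∩ O') ∩ V, w b
        - ∑ b ∈ (P ∩ O') ∩ V, w b - ∑ b ∈ (O ∩ P') ∩ V, w b := by
  rw [← sum_nested_diff_cell w V P O P' O' (hOK.trans hKP) (hOK'.trans hKP')]
  have hdisj : Disjoint (((K \ L) ∩ (L' \ K')) ∩ V) (((L \ K) ∩ (K' \ L')) ∩ V) := by
    rw [Finset.disjoint_left]
    intro b hb hb'
    simp only [Finset.mem_inter, Finset.mem_sdiff] at hb hb'
    exact hb.1.1.2 hb'.1.1.1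
  rw [← Finset.sum_union hdisj]
  apply Finset.sum_le_sum_of_subset_of_nonneg
  · intro b hb
    simp only [Finset.mem_union, Finset.mem_inter, Finset.mem_sdiff] at hb ⊢
    rcases hb with ⟨⟨⟨hk, hl⟩, hl', hk'⟩, hv⟩ | ⟨⟨⟨hl, hk⟩, hk', hl'⟩, hv⟩
    · exact ⟨⟨⟨hKP hk, fun ho => hl (hOL ho)⟩, hLP' hl', fun ho' => hk' (hOK' ho')⟩, hv⟩
    · exact ⟨⟨⟨hLP hl, fun ho => hk (hOK ho)⟩, hKP' hk', fun ho' => hl' (hOL' ho')⟩, hv⟩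
  · intro b hb _
    exact hw b (Finset.mem_inter.1 hb).2

/-- **The uncrossed bound (both brackets share it).**  Pure algebra: with `m = a + c`, `m' = a' + c'` (`a, c, a', c' ≥ 0`),
`(1−v)·m·m' − (m·a' + m'·a − v·m·m') = c·c' − a·a' ≥ −m·m'`. [this work] -/
theorem uncrossed_core (v m a m' a' : ℝ) (ha : 0 ≤ a) (ham : a ≤ m) (ha' : 0 ≤ a') (ham' : a' ≤ m') :
    -(m * m') ≤ (1 - v) * (m * m') - (m * a' + m' * a - v * m * m') := by
  have hc : 0 ≤ (m - a) * (m' - a') := mul_nonneg (by linarith) (by linarith)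
  have haa : a * a' ≤ m * m' := mul_le_mul ham ham' ha' (by linarith)
  nlinarith [hc, haa]

/-- **Core of the dichotomy (bracket-agnostic).**  `B` finite, `w ≥ 0` of total mass `1`, slot `V` (`v = w(V)`); a weight
`R ≥ 0` on `V` with the pair inequality at the uncrossed pairs `(K∪L, K'∩L')`, `(K∩L, K'∪L')` and at the cross pairs `(K,L')`,
`(L,K')`, flow-normal on the crossing cells (`R(Ξ₁) + R(Ξ₂) ≤ (2−v)·(w(Ξ₁) + w(Ξ₂))`); and reals `X, Y` (the `R`-free part and the
bracket) with `w(Ξ₁) + w(Ξ₂) + (1−v)·[m₁m₁' + m₂m₂'] ≤ X + (1−v)·Y` (`m₁ = w(K) − w(K∩L)`, `m₁' = w(L') − w(K'∩L')`,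
`m₂ = w(L) − w(K∩L)`, `m₂' = w(K') − w(K'∩L')`).  Then `X + R(KK'V) + R(LL'V) − need(K,L') − need(L,K') + (1−v)·Y ≥ 0`.
Proof: `T = w(Ξ₁)+w(Ξ₂) − m₁m₁' − m₂m₂'`; the cross packing with overflow gives `≥ −(1−v)·T`, the uncrossed packing gives `≥ T`
(`uncrossed_core`). [this work] -/
theorem exchange_flowNormal_core [Fintype B] (w R : B → ℝ) (hw : ∀ b, 0 ≤ w b) (hw1 : ∑ b, w b = 1)
    (V K L K' L' : Finset B) (hR : ∀ b ∈ V, 0 ≤ R b) (X Y : ℝ)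
    (hpairU₁ : (∑ b ∈ K ∪ L, w b) * (∑ b ∈ (K' ∩ L') ∩ V, w b) + (∑ b ∈ K' ∩ L', w b) * (∑ b ∈ (K ∪ L) ∩ V, w b)
        - (∑ b ∈ V, w b) * (∑ b ∈ K ∪ L, w b) * (∑ b ∈ K' ∩ L', w b) ≤ ∑ b ∈ ((K ∪ L) ∩ (K' ∩ L')) ∩ V, R b)
    (hpairU₂ : (∑ b ∈ K ∩ L, w b) * (∑ b ∈ (K' ∪ L') ∩ V, w b) + (∑ b ∈ K' ∪ L', w b) * (∑ b ∈ (K ∩ L) ∩ V, w b)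
        - (∑ b ∈ V, w b) * (∑ b ∈ K ∩ L, w b) * (∑ b ∈ K' ∪ L', w b) ≤ ∑ b ∈ ((K ∩ L) ∩ (K' ∪ L')) ∩ V, R b)
    (hpair₁ : (∑ b ∈ K, w b) * (∑ b ∈ L' ∩ V, w b) + (∑ b ∈ L', w b) * (∑ b ∈ K ∩ V, w b)
        - (∑ b ∈ V, w b) * (∑ b ∈ K, w b) * (∑ b ∈ L', w b) ≤ ∑ b ∈ (K ∩ L') ∩ V, R b)
    (hpair₂ : (∑ b ∈ L, w b) * (∑ b ∈ K' ∩ V, w b) + (∑ b ∈ K', w b) * (∑ b ∈ L ∩ V, w b)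
        - (∑ b ∈ V, w b) * (∑ b ∈ L, w b) * (∑ b ∈ K', w b) ≤ ∑ b ∈ (L ∩ K') ∩ V, R b)
    (hflat : ∑ b ∈ ((K \ L) ∩ (L' \ K')) ∩ V, R b + ∑ b ∈ ((L \ K) ∩ (K' \ L')) ∩ V, R b
        ≤ (2 - ∑ b ∈ V, w b) * (∑ b ∈ ((K \ L) ∩ (L' \ K')) ∩ V, w b + ∑ b ∈ ((L \ K) ∩ (K' \ L')) ∩ V, w b))
    (hbase : ∑ b ∈ ((K \ L) ∩ (L' \ K')) ∩ V, w b + ∑ b ∈ ((L \ K) ∩ (K' \ L')) ∩ V, w b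
        + (1 - ∑ b ∈ V, w b) * (((∑ b ∈ K, w b) - ∑ b ∈ K ∩ L, w b) * ((∑ b ∈ L', w b) - ∑ b ∈ K' ∩ L', w b)
          + ((∑ b ∈ L, w b) - ∑ b ∈ K ∩ L, w b) * ((∑ b ∈ K', w b) - ∑ b ∈ K' ∩ L', w b)) ≤ X + (1 - ∑ b ∈ V, w b) * Y) :
    0 ≤ X + (∑ b ∈ (K ∩ K') ∩ V, R b) + (∑ b ∈ (L ∩ L') ∩ V, R b)
        - ((∑ b ∈ K, w b) * (∑ b ∈ L' ∩ V, w b) + (∑ b ∈ L', w b) * (∑ b ∈ K ∩ V, w b)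
            - (∑ b ∈ V, w b) * (∑ b ∈ K, w b) * (∑ b ∈ L', w b))
        - ((∑ b ∈ L, w b) * (∑ b ∈ K' ∩ V, w b) + (∑ b ∈ K', w b) * (∑ b ∈ L ∩ V, w b)
            - (∑ b ∈ V, w b) * (∑ b ∈ L, w b) * (∑ b ∈ K', w b))
        + (1 - ∑ b ∈ V, w b) * Y := by
  -- lemma instances first (so that the abbreviations below rewrite them too)
  have hv1 : ∑ b ∈ V, w b ≤ 1 := by rw [← hw1]; exact sum_le_sum_of_subset' w hw (Finset.subset_univ V)
  have hcross := supply_ge_cross_sub_crossing R V K L K' L' hR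
  have hsup := uncrossed_footprints_le_supply R V K L K' L' hR
  have hval := uncrossed_value w V K L K' L' (∑ b ∈ V, w b)
  have hm₁ : (∑ b ∈ K ∩ V, w b) - ∑ b ∈ (K ∩ L) ∩ V, w b ≤ (∑ b ∈ K, w b) - ∑ b ∈ K ∩ L, w b :=
    trace_diff_le w V K (K ∩ L) hw Finset.inter_subset_left
  have hm₂ : (∑ b ∈ L ∩ V, w b) - ∑ b ∈ (K ∩ L) ∩ V, w b ≤ (∑ b ∈ L, w b) - ∑ b ∈ K ∩ L, w b :=
    trace_diff_le w V L (K ∩ L) hw Finset.inter_subset_right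
  have hm₁' : (∑ b ∈ L' ∩ V, w b) - ∑ b ∈ (K' ∩ L') ∩ V, w b ≤ (∑ b ∈ L', w b) - ∑ b ∈ K' ∩ L', w b :=
    trace_diff_le w V L' (K' ∩ L') hw Finset.inter_subset_right
  have hm₂' : (∑ b ∈ K' ∩ V, w b) - ∑ b ∈ (K' ∩ L') ∩ V, w b ≤ (∑ b ∈ K', w b) - ∑ b ∈ K' ∩ L', w b :=
    trace_diff_le w V K' (K' ∩ L') hw Finset.inter_subset_left
  have ha₁ : ∑ b ∈ (K ∩ L) ∩ V, w b ≤ ∑ b ∈ K ∩ V, w b :=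
    sum_le_sum_of_subset' w hw (Finset.inter_subset_inter Finset.inter_subset_left le_rfl)
  have ha₂ : ∑ b ∈ (K ∩ L) ∩ V, w b ≤ ∑ b ∈ L ∩ V, w b :=
    sum_le_sum_of_subset' w hw (Finset.inter_subset_inter Finset.inter_subset_right le_rfl)
  have ha₁' : ∑ b ∈ (K' ∩ L') ∩ V, w b ≤ ∑ b ∈ L' ∩ V, w b :=
    sum_le_sum_of_subset' w hw (Finset.inter_subset_inter Finset.inter_subset_right le_rfl)
  have ha₂' : ∑ b ∈ (K' ∩ L') ∩ V, w b ≤ ∑ b ∈ K' ∩ V, w b :=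
    sum_le_sum_of_subset' w hw (Finset.inter_subset_inter Finset.inter_subset_left le_rfl)
  -- names
  set v := ∑ b ∈ V, w b with hv
  set k := ∑ b ∈ K, w b with hk
  set l := ∑ b ∈ L, w b with hl
  set kl := ∑ b ∈ K ∩ L, w b with hkl
  set k' := ∑ b ∈ K', w b with hk'
  set l' := ∑ b ∈ L', w b with hl'
  set kl' := ∑ b ∈ K' ∩ L', w b with hkl'
  set aK := ∑ b ∈ K ∩ V, w b with haK
  set aL := ∑ b ∈ L ∩ V, w b with haL
  set aKL := ∑ b ∈ (K ∩ L) ∩ V, w b with haKL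
  set aK' := ∑ b ∈ K' ∩ V, w b with haK'
  set aL' := ∑ b ∈ L' ∩ V, w b with haL'
  set aKL' := ∑ b ∈ (K' ∩ L') ∩ V, w b with haKL'
  set ξ₁ := ∑ b ∈ ((K \ L) ∩ (L' \ K')) ∩ V, w b with hξ₁
  set ξ₂ := ∑ b ∈ ((L \ K) ∩ (K' \ L')) ∩ V, w b with hξ₂
  rcases le_or_gt (ξ₁ + ξ₂) ((k - kl) * (l' - kl') + (l - kl) * (k' - kl')) with h1 | h2
  · -- Case 1: cross packing with overflow: EXCH ≥ X + (1-v)Y − (2−v)(ξ₁+ξ₂) ≥ (1−v)(m₁m₁' + m₂m₂' − ξ₁ − ξ₂) ≥ 0.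
    have hvξ : (1 - v) * (ξ₁ + ξ₂) ≤ (1 - v) * ((k - kl) * (l' - kl') + (l - kl) * (k' - kl')) :=
      mul_le_mul_of_nonneg_left h1 (by linarith)
    linarith [hcross, hpair₁, hpair₂, hflat, hbase, hvξ]
  · -- Case 2: uncrossed packing: EXCH ≥ ξ₁+ξ₂ + Σᵢ [(1−v)mᵢmᵢ' − nᵢᵢ] ≥ ξ₁+ξ₂ − m₁m₁' − m₂m₂' > 0.
    have hc₁ := uncrossed_core v (k - kl) (aK - aKL) (l' - kl') (aL' - aKL') (by linarith) hm₁ (by linarith) hm₁'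
    have hc₂ := uncrossed_core v (l - kl) (aL - aKL) (k' - kl') (aK' - aKL') (by linarith) hm₂ (by linarith) hm₂'
    linarith [hsup, hval, hc₁, hc₂, hpairU₁, hpairU₂, hbase, h2]

/-- **The flow-normal 2×2 exchange lemma, general class, bracket of type 2.**  `B` finite, `w ≥ 0` of total mass `1`, slot `V`
(`v = w(V)`), general nestings `O ⊆ K, L ⊆ P`, `O' ⊆ K', L' ⊆ P'`; a weight `R ≥ 0` on `V` satisfying the pair inequality at the
uncrossed pairs `(K∪L, K'∩L')`, `(K∩L, K'∪L')` and at the cross pairs `(K,L')`, `(L,K')`, flow-normal on the crossing cells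
(`R(Ξ₁) + R(Ξ₂) ≤ (2−v)·(w(Ξ₁) + w(Ξ₂))`; e.g. every `R ≤ (2−v)·w` on `V`); Harris' inequality for `(P, O'∩V)`, `(P', O∩V)`,
`(P, P')`.  Then
`a(PP') + a(OO') − p·a(O') − p'·a(O) + R(KK'V) + R(LL'V) − need(K,L') − need(L,K') + (1−v)·[Har(P,P') + (p−k)(p'−l') + (p−l)(p'−k')] ≥ 0`
(the conclusion of `exchange_of_noCross₂` without the crossing-free hypothesis).  The flow-normality hypothesis cannot be dropped
(generation 28's exact Bool⁵ witnesses). [this work] -/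
theorem exchange_flowNormal₂ [Fintype B] (w R : B → ℝ) (hw : ∀ b, 0 ≤ w b) (hw1 : ∑ b, w b = 1)
    (V K L P O K' L' P' O' : Finset B) (hR : ∀ b ∈ V, 0 ≤ R b)
    (hOK : O ⊆ K) (hOL : O ⊆ L) (hKP : K ⊆ P) (hLP : L ⊆ P)
    (hOK' : O' ⊆ K') (hOL' : O' ⊆ L') (hKP' : K' ⊆ P') (hLP' : L' ⊆ P')
    (hpairU₁ : (∑ b ∈ K ∪ L, w b) * (∑ b ∈ (K' ∩ L') ∩ V, w b) + (∑ b ∈ K' ∩ L', w b) * (∑ b ∈ (K ∪ L) ∩ V, w b)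
        - (∑ b ∈ V, w b) * (∑ b ∈ K ∪ L, w b) * (∑ b ∈ K' ∩ L', w b) ≤ ∑ b ∈ ((K ∪ L) ∩ (K' ∩ L')) ∩ V, R b)
    (hpairU₂ : (∑ b ∈ K ∩ L, w b) * (∑ b ∈ (K' ∪ L') ∩ V, w b) + (∑ b ∈ K' ∪ L', w b) * (∑ b ∈ (K ∩ L) ∩ V, w b)
        - (∑ b ∈ V, w b) * (∑ b ∈ K ∩ L, w b) * (∑ b ∈ K' ∪ L', w b) ≤ ∑ b ∈ ((K ∩ L) ∩ (K' ∪ L')) ∩ V, R b)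
    (hpair₁ : (∑ b ∈ K, w b) * (∑ b ∈ L' ∩ V, w b) + (∑ b ∈ L', w b) * (∑ b ∈ K ∩ V, w b)
        - (∑ b ∈ V, w b) * (∑ b ∈ K, w b) * (∑ b ∈ L', w b) ≤ ∑ b ∈ (K ∩ L') ∩ V, R b)
    (hpair₂ : (∑ b ∈ L, w b) * (∑ b ∈ K' ∩ V, w b) + (∑ b ∈ K', w b) * (∑ b ∈ L ∩ V, w b)
        - (∑ b ∈ V, w b) * (∑ b ∈ L, w b) * (∑ b ∈ K', w b) ≤ ∑ b ∈ (L ∩ K') ∩ V, R b)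
    (hflat : ∑ b ∈ ((K \ L) ∩ (L' \ K')) ∩ V, R b + ∑ b ∈ ((L \ K) ∩ (K' \ L')) ∩ V, R b
        ≤ (2 - ∑ b ∈ V, w b) * (∑ b ∈ ((K \ L) ∩ (L' \ K')) ∩ V, w b + ∑ b ∈ ((L \ K) ∩ (K' \ L')) ∩ V, w b))
    (hHar₁ : (∑ b ∈ P, w b) * (∑ b ∈ O' ∩ V, w b) ≤ ∑ b ∈ (P ∩ O') ∩ V, w b)
    (hHar₂ : (∑ b ∈ P', w b) * (∑ b ∈ O ∩ V, w b) ≤ ∑ b ∈ (O ∩ P') ∩ V, w b)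
    (hHar₃ : (∑ b ∈ P, w b) * (∑ b ∈ P', w b) ≤ ∑ b ∈ P ∩ P', w b) :
    0 ≤ (∑ b ∈ (P ∩ P') ∩ V, w b) + (∑ b ∈ (O ∩ O') ∩ V, w b)
        - (∑ b ∈ P, w b) * (∑ b ∈ O' ∩ V, w b) - (∑ b ∈ P', w b) * (∑ b ∈ O ∩ V, w b)
        + (∑ b ∈ (K ∩ K') ∩ V, R b) + (∑ b ∈ (L ∩ L') ∩ V, R b)
        - ((∑ b ∈ K, w b) * (∑ b ∈ L' ∩ V, w b) + (∑ b ∈ L', w b) * (∑ b ∈ K ∩ V, w b)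
            - (∑ b ∈ V, w b) * (∑ b ∈ K, w b) * (∑ b ∈ L', w b))
        - ((∑ b ∈ L, w b) * (∑ b ∈ K' ∩ V, w b) + (∑ b ∈ K', w b) * (∑ b ∈ L ∩ V, w b)
            - (∑ b ∈ V, w b) * (∑ b ∈ L, w b) * (∑ b ∈ K', w b))
        + (1 - ∑ b ∈ V, w b) * ((∑ b ∈ P ∩ P', w b) - (∑ b ∈ P, w b) * (∑ b ∈ P', w b)
            + ((∑ b ∈ P, w b) - ∑ b ∈ K, w b) * ((∑ b ∈ P', w b) - ∑ b ∈ L', w b)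
            + ((∑ b ∈ P, w b) - ∑ b ∈ L, w b) * ((∑ b ∈ P', w b) - ∑ b ∈ K', w b)) := by
  have hv1 : ∑ b ∈ V, w b ≤ 1 := by rw [← hw1]; exact sum_le_sum_of_subset' w hw (Finset.subset_univ V)
  have hcells := crossing_cells_le_modularity w V K L P O K' L' P' O' (fun b _ => hw b) hOK hOL hKP hLP hOK' hOL' hKP' hLP'
  have hkul : ∑ b ∈ K ∪ L, w b ≤ ∑ b ∈ P, w b := sum_le_sum_of_subset' w hw (Finset.union_subset hKP hLP)
  have hkul_eq : ∑ b ∈ K ∪ L, w b = (∑ b ∈ K, w b) + (∑ b ∈ L, w b) - ∑ b ∈ K ∩ L, w b := by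
    have := Finset.sum_union_inter (s₁ := K) (s₂ := L) (f := w); linarith
  have hkul' : ∑ b ∈ K' ∪ L', w b ≤ ∑ b ∈ P', w b := sum_le_sum_of_subset' w hw (Finset.union_subset hKP' hLP')
  have hkul'_eq : ∑ b ∈ K' ∪ L', w b = (∑ b ∈ K', w b) + (∑ b ∈ L', w b) - ∑ b ∈ K' ∩ L', w b := by
    have := Finset.sum_union_inter (s₁ := K') (s₂ := L') (f := w); linarith
  have hklk : ∑ b ∈ K ∩ L, w b ≤ ∑ b ∈ K, w b := sum_le_sum_of_subset' w hw Finset.inter_subset_left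
  have hkll : ∑ b ∈ K ∩ L, w b ≤ ∑ b ∈ L, w b := sum_le_sum_of_subset' w hw Finset.inter_subset_right
  have hklk' : ∑ b ∈ K' ∩ L', w b ≤ ∑ b ∈ K', w b := sum_le_sum_of_subset' w hw Finset.inter_subset_left
  have hkll' : ∑ b ∈ K' ∩ L', w b ≤ ∑ b ∈ L', w b := sum_le_sum_of_subset' w hw Finset.inter_subset_right
  -- the bracket dominates m₁m₁' + m₂m₂'
  have hY₁ : ((∑ b ∈ L, w b) - ∑ b ∈ K ∩ L, w b) * ((∑ b ∈ K', w b) - ∑ b ∈ K' ∩ L', w b)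
      ≤ ((∑ b ∈ P, w b) - ∑ b ∈ K, w b) * ((∑ b ∈ P', w b) - ∑ b ∈ L', w b) :=
    mul_le_mul (by linarith) (by linarith) (by linarith) (by linarith)
  have hY₂ : ((∑ b ∈ K, w b) - ∑ b ∈ K ∩ L, w b) * ((∑ b ∈ L', w b) - ∑ b ∈ K' ∩ L', w b)
      ≤ ((∑ b ∈ P, w b) - ∑ b ∈ L, w b) * ((∑ b ∈ P', w b) - ∑ b ∈ K', w b) :=
    mul_le_mul (by linarith) (by linarith) (by linarith) (by linarith)
  have hvY : (1 - ∑ b ∈ V, w b) * (((∑ b ∈ K, w b) - ∑ b ∈ K ∩ L, w b) * ((∑ b ∈ L', w b) - ∑ b ∈ K' ∩ L', w b)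
        + ((∑ b ∈ L, w b) - ∑ b ∈ K ∩ L, w b) * ((∑ b ∈ K', w b) - ∑ b ∈ K' ∩ L', w b))
      ≤ (1 - ∑ b ∈ V, w b) * ((∑ b ∈ P ∩ P', w b) - (∑ b ∈ P, w b) * (∑ b ∈ P', w b)
        + ((∑ b ∈ P, w b) - ∑ b ∈ K, w b) * ((∑ b ∈ P', w b) - ∑ b ∈ L', w b)
        + ((∑ b ∈ P, w b) - ∑ b ∈ L, w b) * ((∑ b ∈ P', w b) - ∑ b ∈ K', w b)) :=
    mul_le_mul_of_nonneg_left (by linarith) (by linarith)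
  have hcore := exchange_flowNormal_core w R hw hw1 V K L K' L' hR
    ((∑ b ∈ (P ∩ P') ∩ V, w b) + (∑ b ∈ (O ∩ O') ∩ V, w b)
        - (∑ b ∈ P, w b) * (∑ b ∈ O' ∩ V, w b) - (∑ b ∈ P', w b) * (∑ b ∈ O ∩ V, w b))
    ((∑ b ∈ P ∩ P', w b) - (∑ b ∈ P, w b) * (∑ b ∈ P', w b)
        + ((∑ b ∈ P, w b) - ∑ b ∈ K, w b) * ((∑ b ∈ P', w b) - ∑ b ∈ L', w b)
        + ((∑ b ∈ P, w b) - ∑ b ∈ L, w b) * ((∑ b ∈ P', w b) - ∑ b ∈ K', w b))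
    hpairU₁ hpairU₂ hpair₁ hpair₂ hflat (by linarith [hcells, hHar₁, hHar₂, hvY])
  linarith [hcore]

/-- **The flow-normal 2×2 exchange lemma, general class, bracket of type 1** (the shape of `D₁`): same data, with the bracket
`[Har(P,P') + (p−k)(k'−o') + (p−o)(p'−k')]` (the conclusion of `exchange_of_noCross₁` without the crossing-free hypothesis).
[this work] -/
theorem exchange_flowNormal₁ [Fintype B] (w R : B → ℝ) (hw : ∀ b, 0 ≤ w b) (hw1 : ∑ b, w b = 1)
    (V K L P O K' L' P' O' : Finset B) (hR : ∀ b ∈ V, 0 ≤ R b)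
    (hOK : O ⊆ K) (hOL : O ⊆ L) (hKP : K ⊆ P) (hLP : L ⊆ P)
    (hOK' : O' ⊆ K') (hOL' : O' ⊆ L') (hKP' : K' ⊆ P') (hLP' : L' ⊆ P')
    (hpairU₁ : (∑ b ∈ K ∪ L, w b) * (∑ b ∈ (K' ∩ L') ∩ V, w b) + (∑ b ∈ K' ∩ L', w b) * (∑ b ∈ (K ∪ L) ∩ V, w b)
        - (∑ b ∈ V, w b) * (∑ b ∈ K ∪ L, w b) * (∑ b ∈ K' ∩ L', w b) ≤ ∑ b ∈ ((K ∪ L) ∩ (K' ∩ L')) ∩ V, R b)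
    (hpairU₂ : (∑ b ∈ K ∩ L, w b) * (∑ b ∈ (K' ∪ L') ∩ V, w b) + (∑ b ∈ K' ∪ L', w b) * (∑ b ∈ (K ∩ L) ∩ V, w b)
        - (∑ b ∈ V, w b) * (∑ b ∈ K ∩ L, w b) * (∑ b ∈ K' ∪ L', w b) ≤ ∑ b ∈ ((K ∩ L) ∩ (K' ∪ L')) ∩ V, R b)
    (hpair₁ : (∑ b ∈ K, w b) * (∑ b ∈ L' ∩ V, w b) + (∑ b ∈ L', w b) * (∑ b ∈ K ∩ V, w b)
        - (∑ b ∈ V, w b) * (∑ b ∈ K, w b) * (∑ b ∈ L', w b) ≤ ∑ b ∈ (K ∩ L') ∩ V, R b)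
    (hpair₂ : (∑ b ∈ L, w b) * (∑ b ∈ K' ∩ V, w b) + (∑ b ∈ K', w b) * (∑ b ∈ L ∩ V, w b)
        - (∑ b ∈ V, w b) * (∑ b ∈ L, w b) * (∑ b ∈ K', w b) ≤ ∑ b ∈ (L ∩ K') ∩ V, R b)
    (hflat : ∑ b ∈ ((K \ L) ∩ (L' \ K')) ∩ V, R b + ∑ b ∈ ((L \ K) ∩ (K' \ L')) ∩ V, R b
        ≤ (2 - ∑ b ∈ V, w b) * (∑ b ∈ ((K \ L) ∩ (L' \ K')) ∩ V, w b + ∑ b ∈ ((L \ K) ∩ (K' \ L')) ∩ V, w b))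
    (hHar₁ : (∑ b ∈ P, w b) * (∑ b ∈ O' ∩ V, w b) ≤ ∑ b ∈ (P ∩ O') ∩ V, w b)
    (hHar₂ : (∑ b ∈ P', w b) * (∑ b ∈ O ∩ V, w b) ≤ ∑ b ∈ (O ∩ P') ∩ V, w b)
    (hHar₃ : (∑ b ∈ P, w b) * (∑ b ∈ P', w b) ≤ ∑ b ∈ P ∩ P', w b) :
    0 ≤ (∑ b ∈ (P ∩ P') ∩ V, w b) + (∑ b ∈ (O ∩ O') ∩ V, w b)
        - (∑ b ∈ P, w b) * (∑ b ∈ O' ∩ V, w b) - (∑ b ∈ P', w b) * (∑ b ∈ O ∩ V, w b)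
        + (∑ b ∈ (K ∩ K') ∩ V, R b) + (∑ b ∈ (L ∩ L') ∩ V, R b)
        - ((∑ b ∈ K, w b) * (∑ b ∈ L' ∩ V, w b) + (∑ b ∈ L', w b) * (∑ b ∈ K ∩ V, w b)
            - (∑ b ∈ V, w b) * (∑ b ∈ K, w b) * (∑ b ∈ L', w b))
        - ((∑ b ∈ L, w b) * (∑ b ∈ K' ∩ V, w b) + (∑ b ∈ K', w b) * (∑ b ∈ L ∩ V, w b)
            - (∑ b ∈ V, w b) * (∑ b ∈ L, w b) * (∑ b ∈ K', w b))
        + (1 - ∑ b ∈ V, w b) * ((∑ b ∈ P ∩ P', w b) - (∑ b ∈ P, w b) * (∑ b ∈ P', w b)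
            + ((∑ b ∈ P, w b) - ∑ b ∈ K, w b) * ((∑ b ∈ K', w b) - ∑ b ∈ O', w b)
            + ((∑ b ∈ P, w b) - ∑ b ∈ O, w b) * ((∑ b ∈ P', w b) - ∑ b ∈ K', w b)) := by
  have hv1 : ∑ b ∈ V, w b ≤ 1 := by rw [← hw1]; exact sum_le_sum_of_subset' w hw (Finset.subset_univ V)
  have hcells := crossing_cells_le_modularity w V K L P O K' L' P' O' (fun b _ => hw b) hOK hOL hKP hLP hOK' hOL' hKP' hLP'
  have hkul : ∑ b ∈ K ∪ L, w b ≤ ∑ b ∈ P, w b := sum_le_sum_of_subset' w hw (Finset.union_subset hKP hLP)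
  have hkul_eq : ∑ b ∈ K ∪ L, w b = (∑ b ∈ K, w b) + (∑ b ∈ L, w b) - ∑ b ∈ K ∩ L, w b := by
    have := Finset.sum_union_inter (s₁ := K) (s₂ := L) (f := w); linarith
  have hkul' : ∑ b ∈ K' ∪ L', w b ≤ ∑ b ∈ P', w b := sum_le_sum_of_subset' w hw (Finset.union_subset hKP' hLP')
  have hkul'_eq : ∑ b ∈ K' ∪ L', w b = (∑ b ∈ K', w b) + (∑ b ∈ L', w b) - ∑ b ∈ K' ∩ L', w b := by
    have := Finset.sum_union_inter (s₁ := K') (s₂ := L') (f := w); linarith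
  have hkp : ∑ b ∈ K, w b ≤ ∑ b ∈ P, w b := sum_le_sum_of_subset' w hw hKP
  have ho : ∑ b ∈ O, w b ≤ ∑ b ∈ K ∩ L, w b := sum_le_sum_of_subset' w hw (Finset.subset_inter hOK hOL)
  have ho' : ∑ b ∈ O', w b ≤ ∑ b ∈ K' ∩ L', w b := sum_le_sum_of_subset' w hw (Finset.subset_inter hOK' hOL')
  have hklk : ∑ b ∈ K ∩ L, w b ≤ ∑ b ∈ K, w b := sum_le_sum_of_subset' w hw Finset.inter_subset_left
  have hkll : ∑ b ∈ K ∩ L, w b ≤ ∑ b ∈ L, w b := sum_le_sum_of_subset' w hw Finset.inter_subset_right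
  have hklk' : ∑ b ∈ K' ∩ L', w b ≤ ∑ b ∈ K', w b := sum_le_sum_of_subset' w hw Finset.inter_subset_left
  have hkll' : ∑ b ∈ K' ∩ L', w b ≤ ∑ b ∈ L', w b := sum_le_sum_of_subset' w hw Finset.inter_subset_right
  -- the bracket dominates m₁m₁' + m₂m₂':  (p−k) ≥ l − kl, (k'−o') ≥ k' − k'l';  (p−o) ≥ k − kl, (p'−k') ≥ l' − k'l'
  have hY₁ : ((∑ b ∈ L, w b) - ∑ b ∈ K ∩ L, w b) * ((∑ b ∈ K', w b) - ∑ b ∈ K' ∩ L', w b)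
      ≤ ((∑ b ∈ P, w b) - ∑ b ∈ K, w b) * ((∑ b ∈ K', w b) - ∑ b ∈ O', w b) :=
    mul_le_mul (by linarith) (by linarith) (by linarith) (by linarith)
  have hY₂ : ((∑ b ∈ K, w b) - ∑ b ∈ K ∩ L, w b) * ((∑ b ∈ L', w b) - ∑ b ∈ K' ∩ L', w b)
      ≤ ((∑ b ∈ P, w b) - ∑ b ∈ O, w b) * ((∑ b ∈ P', w b) - ∑ b ∈ K', w b) :=
    mul_le_mul (by linarith) (by linarith) (by linarith) (by linarith)
  have hvY : (1 - ∑ b ∈ V, w b) * (((∑ b ∈ K, w b) - ∑ b ∈ K ∩ L, w b) * ((∑ b ∈ L', w b) - ∑ b ∈ K' ∩ L', w b)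
        + ((∑ b ∈ L, w b) - ∑ b ∈ K ∩ L, w b) * ((∑ b ∈ K', w b) - ∑ b ∈ K' ∩ L', w b))
      ≤ (1 - ∑ b ∈ V, w b) * ((∑ b ∈ P ∩ P', w b) - (∑ b ∈ P, w b) * (∑ b ∈ P', w b)
        + ((∑ b ∈ P, w b) - ∑ b ∈ K, w b) * ((∑ b ∈ K', w b) - ∑ b ∈ O', w b)
        + ((∑ b ∈ P, w b) - ∑ b ∈ O, w b) * ((∑ b ∈ P', w b) - ∑ b ∈ K', w b)) :=
    mul_le_mul_of_nonneg_left (by linarith) (by linarith)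
  have hcore := exchange_flowNormal_core w R hw hw1 V K L K' L' hR
    ((∑ b ∈ (P ∩ P') ∩ V, w b) + (∑ b ∈ (O ∩ O') ∩ V, w b)
        - (∑ b ∈ P, w b) * (∑ b ∈ O' ∩ V, w b) - (∑ b ∈ P', w b) * (∑ b ∈ O ∩ V, w b))
    ((∑ b ∈ P ∩ P', w b) - (∑ b ∈ P, w b) * (∑ b ∈ P', w b)
        + ((∑ b ∈ P, w b) - ∑ b ∈ K, w b) * ((∑ b ∈ K', w b) - ∑ b ∈ O', w b)
        + ((∑ b ∈ P, w b) - ∑ b ∈ O, w b) * ((∑ b ∈ P', w b) - ∑ b ∈ K', w b))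
    hpairU₁ hpairU₂ hpair₁ hpair₂ hflat (by linarith [hcells, hHar₁, hHar₂, hvY])
  linarith [hcore]

end Summit.CriticalPhenomena.PercolationContinuityZ3.Theorems.SahiE3ExchangeGeneral
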